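import Mathlib
import HarnessLib
import Summits.NavierStokesRegularity.NavierStokesRegularity.Theorems.PoloidalWindowRigidity.Negative.DriftProfile
import Literature.Algebra.EuclideanLattices.FccBccLattices
import Literature.Analysis.FluidPDE.AxisymmetricSingularSetOnAxis
import Literature.Analysis.FluidPDE.EulerTimeScaling

/-!
# Crux `PoloidalWindowRigidity` (K2, stmt-NavierStokesRegularity-19708) — negative side:
# the cellular witnesses are axisymmetric in NO rigid frame (the any-frame clause of the residue)

Negative-side support (refuter seat ns-regularity-refuter1 gen 2, cell ns-regularity-ideate; D-0081 §C).  The residue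
stubs of line `slicesharp-screw` (rev 8 S2″, rev 9 S2‴, rev 10 S2⁗) carry the clause
«`∀ s < 0, ∀ (L : ℝ³ ≃ₗᵢ ℝ³) c, ¬ IsAxisymmetric (fun y ↦ L⁻¹ (v s (L y + c)))`» (axisymmetric — with or without swirl — in
no rigid frame).  The standing certificates `…Negative.ResidueRev8False` (p475628) and `…Negative.ResidueRev9False` had to
DELETE this clause (only the no-swirl version was certified, `…Negative.SwirlEveryAxis`).  This file certifies it:

* `norm_sq_cellField_le`, `cos_eq_zero_of_norm_sq_cellField_eq_four` — `|V(x)|² ≤ 4` with equality only where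
  `cos x₀ = cos x₁ = cos x₂ = 0` (a subset of the lattice `(π/2 + πℤ)³`);
* `eq_zero_of_rotZ_eq_self` — a rotation by an angle with `cos θ ≠ 1` fixes only the axis (`rotZ_smul`,
  `continuous_rotZ_angle` are reused from Literature);
* `cellField_not_axisymmetric_anyFrame` — MAX-SET ARGUMENT: if `z ↦ L⁻¹ V(L z + c)` were axisymmetric, `|V|²` would be
  invariant under the rotations of the frame; a maximum point `P` (`|V(P)|² = 4`) rotated by a small angle is again a
  maximum point within distance `1` of `P`, hence equal to `P` (the maximum set is `π`-separated), so `P` lies on the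
  axis of the frame; but the three maximum points `(π/2,π/2,π/2)`, `+2π e₀`, `+2π e₁` are not collinear
  (they would force `L⁻¹e₀, L⁻¹e₁ ∈ ℝ e₂`, contradicting orthonormality);
* `driftProfile_not_axisymmetric_anyFrame` — the same for every slice `s < 0` of the drifting profile (rescaling and
  recentring the frame, as in `driftProfile_swirl_every_axis`).

The argument is witness-independent given an explicit, `π`-separated, non-collinear maximum set of a rotation-invariant
scalar (`|v|²` here; `|ω|²` for other members of the cellular family).
WHAT THIS IS NOT: not a claim about Navier–Stokes — kinematics of an explicit profile. [folklore]
-/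

noncomputable section

-- the summit and its single sub-problem share the name (CONVENTIONS §1), as in every Theorems file
set_option linter.dupNamespace false

namespace Summit.NavierStokesRegularity.NavierStokesRegularity.Theorems.PoloidalWindowRigidity.Negative

open Set Function
open scoped RealInnerProductSpace InnerProductSpace
open Literature.Analysis Literature.Analysis.FluidPDE

/-! ### The maximum set of `|V|²` -/

/-- `|V(x)|² ≤ 4`. [folklore] -/
theorem norm_sq_cellField_le (x : EuclideanSpace ℝ (Fin 3)) : ‖cellField x‖ ^ 2 ≤ 4 := by
  rw [Literature.Algebra.EuclideanLattices.norm_sq_fin_three, cellField_apply_zero, cellField_apply_one,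
    cellField_apply_two]
  have h0 := Real.sin_sq_add_cos_sq (x 0)
  have h1 := Real.sin_sq_add_cos_sq (x 1)
  have h2 := Real.sin_sq_add_cos_sq (x 2)
  have hA : 0 ≤ 4 - Real.cos (x 0) ^ 2 - Real.cos (x 1) ^ 2 := by
    nlinarith [Real.cos_sq_le_one (x 0), Real.cos_sq_le_one (x 1)]
  have hB : 0 ≤ 4 - (Real.sin (x 0) + Real.sin (x 1)) ^ 2 := by
    nlinarith [sq_nonneg (Real.sin (x 0) - Real.sin (x 1)), Real.sin_sq_le_one (x 0), Real.sin_sq_le_one (x 1)]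
  nlinarith [mul_nonneg (sq_nonneg (Real.cos (x 2))) hA, mul_nonneg (sq_nonneg (Real.sin (x 2))) hB]

/-- `|V(x)|² = 4` only where `cos x₀ = cos x₁ = cos x₂ = 0`. [folklore] -/
theorem cos_eq_zero_of_norm_sq_cellField_eq_four {x : EuclideanSpace ℝ (Fin 3)} (h : ‖cellField x‖ ^ 2 = 4) :
    Real.cos (x 0) = 0 ∧ Real.cos (x 1) = 0 ∧ Real.cos (x 2) = 0 := by
  rw [Literature.Algebra.EuclideanLattices.norm_sq_fin_three, cellField_apply_zero, cellField_apply_one,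
    cellField_apply_two] at h
  have h0 := Real.sin_sq_add_cos_sq (x 0)
  have h1 := Real.sin_sq_add_cos_sq (x 1)
  have h2 := Real.sin_sq_add_cos_sq (x 2)
  have hc0 := Real.cos_sq_le_one (x 0)
  have hc1 := Real.cos_sq_le_one (x 1)
  have hB : 0 ≤ 4 - (Real.sin (x 0) + Real.sin (x 1)) ^ 2 := by
    nlinarith [sq_nonneg (Real.sin (x 0) - Real.sin (x 1)), Real.sin_sq_le_one (x 0), Real.sin_sq_le_one (x 1)]
  -- `cos x₂ = 0`
  have hc2sq : Real.cos (x 2) ^ 2 = 0 := by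
    nlinarith [mul_nonneg (sq_nonneg (Real.cos (x 2))) (sub_nonneg.2 hc0),
      mul_nonneg (sq_nonneg (Real.cos (x 2))) (sub_nonneg.2 hc1), mul_nonneg (sq_nonneg (Real.sin (x 2))) hB,
      sq_nonneg (Real.cos (x 2))]
  have hc2 : Real.cos (x 2) = 0 := pow_eq_zero_iff (n := 2) (by norm_num) |>.1 hc2sq
  have hs2 : Real.sin (x 2) ^ 2 = 1 := by nlinarith [h2, hc2sq]
  -- `(sin x₀ + sin x₁)² = 4`, hence `cos x₀ = cos x₁ = 0`
  rw [hc2] at h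
  have hsum : (Real.sin (x 0) + Real.sin (x 1)) ^ 2 = 4 := by nlinarith [h, hs2]
  have hc0sq : Real.cos (x 0) ^ 2 = 0 := by
    nlinarith [sq_nonneg (Real.sin (x 0) - Real.sin (x 1)), sq_nonneg (Real.cos (x 0)), sq_nonneg (Real.cos (x 1))]
  have hc1sq : Real.cos (x 1) ^ 2 = 0 := by
    nlinarith [sq_nonneg (Real.sin (x 0) - Real.sin (x 1)), sq_nonneg (Real.cos (x 0)), sq_nonneg (Real.cos (x 1))]
  exact ⟨pow_eq_zero_iff (n := 2) (by norm_num) |>.1 hc0sq, pow_eq_zero_iff (n := 2) (by norm_num) |>.1 hc1sq, hc2⟩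

/-- Two zeros of `cos` at distance `< π` coincide. [folklore] -/
theorem eq_of_cos_eq_zero_of_abs_sub_lt {a b : ℝ} (ha : Real.cos a = 0) (hb : Real.cos b = 0) (h : |a - b| < Real.pi) :
    a = b := by
  obtain ⟨k, hk⟩ := Real.cos_eq_zero_iff.1 ha
  obtain ⟨m, hm⟩ := Real.cos_eq_zero_iff.1 hb
  have hsub : a - b = (k - m : ℤ) * Real.pi := by rw [hk, hm]; push_cast; ring
  have habs : |((k - m : ℤ) : ℝ)| < 1 := by
    rw [hsub, abs_mul, abs_of_pos Real.pi_pos] at h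
    by_contra hge
    push Not at hge
    have := mul_le_mul_of_nonneg_right hge Real.pi_pos.le
    linarith
  have hkm : k - m = 0 := by
    have h1 : |(k - m : ℤ)| < 1 := by exact_mod_cast habs
    have h2 := abs_lt.1 h1
    omega
  have : a - b = 0 := by rw [hsub, hkm]; simp
  linarith

/-- The maximum set of `|V|²` is `π`-separated: two maximum points at distance `< 1` coincide. [folklore] -/
theorem eq_of_norm_sq_cellField_eq_four {x P : EuclideanSpace ℝ (Fin 3)} (hx : ‖cellField x‖ ^ 2 = 4)
    (hP : ‖cellField P‖ ^ 2 = 4) (hd : dist x P < 1) : x = P := by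
  obtain ⟨hx0, hx1, hx2⟩ := cos_eq_zero_of_norm_sq_cellField_eq_four hx
  obtain ⟨hP0, hP1, hP2⟩ := cos_eq_zero_of_norm_sq_cellField_eq_four hP
  have hcoord : ∀ i : Fin 3, |x i - P i| < Real.pi := by
    intro i
    have h1 : |x i - P i| ≤ dist x P := by
      rw [← Real.dist_eq]
      exact PiLp.dist_apply_le x P i
    linarith [Real.pi_gt_three]
  ext i
  fin_cases i
  · exact eq_of_cos_eq_zero_of_abs_sub_lt hx0 hP0 (hcoord 0)
  · exact eq_of_cos_eq_zero_of_abs_sub_lt hx1 hP1 (hcoord 1)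
  · exact eq_of_cos_eq_zero_of_abs_sub_lt hx2 hP2 (hcoord 2)

/-! ### Rotations -/

/-- A rotation by an angle with `cos θ ≠ 1` fixes only points of the axis. [folklore] -/
theorem eq_zero_of_rotZ_eq_self {θ : ℝ} (hθ : Real.cos θ ≠ 1) {z : EuclideanSpace ℝ (Fin 3)} (h : rotZ θ z = z) :
    z 0 = 0 ∧ z 1 = 0 := by
  have h0 := congrArg (fun w : EuclideanSpace ℝ (Fin 3) => w 0) h
  have h1 := congrArg (fun w : EuclideanSpace ℝ (Fin 3) => w 1) h
  simp only [rotZ_apply_zero, rotZ_apply_one] at h0 h1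
  have hsc := Real.sin_sq_add_cos_sq θ
  have k0 : (2 - 2 * Real.cos θ) * z 0 = 0 := by
    linear_combination (Real.cos θ - 1) * h0 + Real.sin θ * h1 - z 0 * hsc
  have k1 : (2 - 2 * Real.cos θ) * z 1 = 0 := by
    linear_combination (-Real.sin θ) * h0 + (Real.cos θ - 1) * h1 - z 1 * hsc
  have hne : 2 - 2 * Real.cos θ ≠ 0 := by
    intro h2
    exact hθ (by linarith)
  exact ⟨(mul_eq_zero.1 k0).resolve_left hne, (mul_eq_zero.1 k1).resolve_left hne⟩

/-! ### The cellular field is axisymmetric in no frame -/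

/-- **The cellular field is axisymmetric (with or without swirl) in NO rigid frame**: for every linear isometry `L` of
`ℝ³` and every centre `c`, the conjugated field `z ↦ L⁻¹ V(L z + c)` is not axisymmetric. [folklore] -/
theorem cellField_not_axisymmetric_anyFrame (L : EuclideanSpace ℝ (Fin 3) ≃ₗᵢ[ℝ] EuclideanSpace ℝ (Fin 3))
    (c : EuclideanSpace ℝ (Fin 3)) : ¬ IsAxisymmetric (fun z => L.symm (cellField (L z + c))) := by
  intro hax
  -- ## `|V|²` is invariant under the rotations of the frame
  have hnorm : ∀ (θ : ℝ) (z : EuclideanSpace ℝ (Fin 3)), ‖cellField (L (rotZ θ z) + c)‖ = ‖cellField (L z + c)‖ := by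
    intro θ z
    have h := congrArg (fun w : EuclideanSpace ℝ (Fin 3) => ‖w‖) (hax θ z)
    simpa only [LinearIsometryEquiv.norm_map, norm_rotZ] using h
  -- ## every maximum point of `|V|²` lies on the axis of the frame
  have haxis : ∀ P : EuclideanSpace ℝ (Fin 3), ‖cellField P‖ ^ 2 = 4 →
      (L.symm (P - c)) 0 = 0 ∧ (L.symm (P - c)) 1 = 0 := by
    intro P hP
    set z : EuclideanSpace ℝ (Fin 3) := L.symm (P - c) with hz
    have hzP : L z + c = P := by simp [hz]
    have hcont : Continuous fun θ : ℝ => L (rotZ θ z) + c :=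
      (L.continuous.comp (continuous_rotZ_angle z)).add continuous_const
    obtain ⟨δ, hδ, hball⟩ := Metric.continuous_iff.1 hcont 0 1 one_pos
    set θ : ℝ := min (δ / 2) 1 with hθ
    have hθpos : 0 < θ := lt_min (by linarith) one_pos
    have hθδ : θ < δ := lt_of_le_of_lt (min_le_left _ _) (by linarith)
    have hθ1 : θ ≤ 1 := min_le_right _ _
    have hcosθ : Real.cos θ ≠ 1 := by
      intro h1
      have h0 := (Real.cos_eq_one_iff_of_lt_of_lt (by linarith [Real.pi_gt_three]) (by linarith [Real.pi_gt_three])).1 h1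
      exact hθpos.ne' h0
    have hclose : dist (L (rotZ θ z) + c) P < 1 := by
      have h := hball θ (by rw [Real.dist_eq, sub_zero, abs_of_pos hθpos]; exact hθδ)
      rwa [rotZ_zero, hzP] at h
    have hmax : ‖cellField (L (rotZ θ z) + c)‖ ^ 2 = 4 := by rw [hnorm θ z, hzP, hP]
    have hEq : L (rotZ θ z) + c = P := eq_of_norm_sq_cellField_eq_four hmax hP hclose
    have hfix : rotZ θ z = z := L.injective (add_right_cancel (hEq.trans hzP.symm))
    exact eq_zero_of_rotZ_eq_self hcosθ hfix
  -- ## three non-collinear maximum points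
  set P₀ : EuclideanSpace ℝ (Fin 3) := (Real.pi / 2) • EuclideanSpace.single (0 : Fin 3) (1 : ℝ) +
    (Real.pi / 2) • EuclideanSpace.single (1 : Fin 3) (1 : ℝ) + (Real.pi / 2) • EuclideanSpace.single (2 : Fin 3) (1 : ℝ)
    with hP₀
  have hmaxP : ∀ u : EuclideanSpace ℝ (Fin 3), Real.cos (u 0) = 0 → Real.cos (u 1) = 0 → Real.cos (u 2) = 0 →
      Real.sin (u 0) = 1 → Real.sin (u 1) = 1 → Real.sin (u 2) = 1 → ‖cellField u‖ ^ 2 = 4 := by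
    intro u h0 h1 h2 h3 h4 h5
    rw [Literature.Algebra.EuclideanLattices.norm_sq_fin_three, cellField_apply_zero, cellField_apply_one,
      cellField_apply_two, h0, h1, h2, h3, h4, h5]
    norm_num
  have hP₀max : ‖cellField P₀‖ ^ 2 = 4 := by
    apply hmaxP <;> simp [hP₀]
  have hP₁max : ‖cellField (P₀ + (2 * Real.pi) • EuclideanSpace.single (0 : Fin 3) (1 : ℝ))‖ ^ 2 = 4 := by
    apply hmaxP <;> simp [hP₀, Real.cos_add_two_pi, Real.sin_add_two_pi]
  have hP₂max : ‖cellField (P₀ + (2 * Real.pi) • EuclideanSpace.single (1 : Fin 3) (1 : ℝ))‖ ^ 2 = 4 := by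
    apply hmaxP <;> simp [hP₀, Real.cos_add_two_pi, Real.sin_add_two_pi]
  obtain ⟨h00, h01⟩ := haxis _ hP₀max
  obtain ⟨h10, h11⟩ := haxis _ hP₁max
  obtain ⟨h20, h21⟩ := haxis _ hP₂max
  -- ## hence `L⁻¹ e₀` and `L⁻¹ e₁` are vertical
  have hvert : ∀ j : Fin 3, (L.symm (P₀ + (2 * Real.pi) • EuclideanSpace.single j (1 : ℝ) - c)) 0 = 0 →
      (L.symm (P₀ + (2 * Real.pi) • EuclideanSpace.single j (1 : ℝ) - c)) 1 = 0 →
      (L.symm (EuclideanSpace.single j (1 : ℝ))) 0 = 0 ∧ (L.symm (EuclideanSpace.single j (1 : ℝ))) 1 = 0 := by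
    intro j hj0 hj1
    have hd : L.symm (P₀ + (2 * Real.pi) • EuclideanSpace.single j (1 : ℝ) - c) - L.symm (P₀ - c) =
        (2 * Real.pi) • L.symm (EuclideanSpace.single j (1 : ℝ)) := by
      rw [← map_sub, ← map_smul]
      congr 1
      abel
    have e0 := congrArg (fun w : EuclideanSpace ℝ (Fin 3) => w 0) hd
    have e1 := congrArg (fun w : EuclideanSpace ℝ (Fin 3) => w 1) hd
    simp only [PiLp.sub_apply, PiLp.smul_apply, smul_eq_mul, hj0, hj1, h00, h01, sub_zero] at e0 e1
    have hπ : (2 * Real.pi) ≠ 0 := by positivity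
    exact ⟨by rcases mul_eq_zero.1 e0.symm with h | h <;> [exact absurd h hπ; exact h],
      by rcases mul_eq_zero.1 e1.symm with h | h <;> [exact absurd h hπ; exact h]⟩
  obtain ⟨hf00, hf01⟩ := hvert 0 h10 h11
  obtain ⟨hf10, hf11⟩ := hvert 1 h20 h21
  -- ## contradiction with orthonormality of `L⁻¹ e₀`, `L⁻¹ e₁`
  have hinner : ⟪L.symm (EuclideanSpace.single (0 : Fin 3) (1 : ℝ)), L.symm (EuclideanSpace.single (1 : Fin 3) (1 : ℝ))⟫_ℝ = 0 := by
    rw [LinearIsometryEquiv.inner_map_map, EuclideanSpace.inner_single_left]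
    simp
  have hn0 : ‖L.symm (EuclideanSpace.single (0 : Fin 3) (1 : ℝ))‖ ^ 2 = 1 := by
    rw [LinearIsometryEquiv.norm_map]; simp
  have hn1 : ‖L.symm (EuclideanSpace.single (1 : Fin 3) (1 : ℝ))‖ ^ 2 = 1 := by
    rw [LinearIsometryEquiv.norm_map]; simp
  rw [Literature.Algebra.EuclideanLattices.inner_fin_three, hf00, hf01] at hinner
  rw [Literature.Algebra.EuclideanLattices.norm_sq_fin_three, hf00, hf01] at hn0
  rw [Literature.Algebra.EuclideanLattices.norm_sq_fin_three, hf10, hf11] at hn1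
  simp only [zero_mul, zero_add, ne_eq, OfNat.ofNat_ne_zero, not_false_eq_true, zero_pow] at hinner hn0 hn1
  rcases mul_eq_zero.1 hinner with h | h
  · rw [h] at hn0; norm_num at hn0
  · rw [h] at hn1; norm_num at hn1

/-- **No slice of the drifting cellular profile is axisymmetric in any rigid frame** (the any-frame clause of the
residue stubs S2″/S2‴/S2⁗ holds for the standing witness). [folklore] -/
theorem driftProfile_not_axisymmetric_anyFrame {s : ℝ} (hs : s < 0)
    (L : EuclideanSpace ℝ (Fin 3) ≃ₗᵢ[ℝ] EuclideanSpace ℝ (Fin 3)) (c : EuclideanSpace ℝ (Fin 3)) :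
    ¬ IsAxisymmetric (fun y => L.symm (driftProfile s (L y + c))) := by
  intro hax
  have ha := (cellAmp_pos hs).ne'
  apply cellField_not_axisymmetric_anyFrame L (cellAmp s • c + Real.log (-s) • EuclideanSpace.single (1 : Fin 3) (1 : ℝ))
  intro θ z
  have key : ∀ y : EuclideanSpace ℝ (Fin 3), L.symm (driftProfile s (L y + c)) =
      cellAmp s • L.symm (cellField (L (cellAmp s • y) +
        (cellAmp s • c + Real.log (-s) • EuclideanSpace.single (1 : Fin 3) (1 : ℝ)))) := by
    intro y
    simp only [driftProfile, driftShift, map_smul, smul_add, add_assoc]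
  have h : L.symm (driftProfile s (L (rotZ θ ((cellAmp s)⁻¹ • z)) + c)) =
      rotZ θ (L.symm (driftProfile s (L ((cellAmp s)⁻¹ • z) + c))) := hax θ ((cellAmp s)⁻¹ • z)
  have hz1 : cellAmp s • rotZ θ ((cellAmp s)⁻¹ • z) = rotZ θ z := by
    rw [← rotZ_smul, smul_smul, mul_inv_cancel₀ ha, one_smul]
  have hz2 : cellAmp s • ((cellAmp s)⁻¹ • z) = z := by rw [smul_smul, mul_inv_cancel₀ ha, one_smul]
  rw [key, key, hz1, hz2, rotZ_smul] at h
  -- `h : a • L⁻¹ V(L (R_θ z) + c') = a • R_θ (L⁻¹ V(L z + c'))`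
  exact smul_right_injective _ ha h

end Summit.NavierStokesRegularity.NavierStokesRegularity.Theorems.PoloidalWindowRigidity.Negative

end
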